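import Summits.Parity.GeneralizedHardyLittlewood.Theorems.GreenTaoLevelTwoMNTwoMajorArcFinal
import Summits.Parity.GeneralizedHardyLittlewood.Theorems.GreenTaoLevelTwoMNTwoPropNineteenGlue

/-!
# Route `GreenTaoLevelTwo`, crux `MNTwo` (stmt-Parity-21276), line `birth`, stub `stub_mnVertical`:
# Proposition 19 from the major-arc inverse statement of §§9–11 (GT 2008b §§9–12 assembled)

Assembly for blocks V4–V6 of the `stub_mnVertical` census (B. Green, T. Tao, *Quadratic uniformity
of the Möbius function*, Ann. Inst. Fourier 58 (2008) = arXiv:math/0606087, §§9–12): the logic of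
§§9–12 is "assume (ortho-targ) fails ⇒ (§§9–11, Lemma 28) `φ` is major arc with `q ≲ 1`, `ρ₃ ≳ 1`
⇒ (§12) (ortho-targ) holds after all".  This def-free file performs exactly this assembly: from the
MAJOR-ARC INVERSE STATEMENT (hypothesis `hInv`, the deliverable of blocks V4–V5 = §§9–11: if
`‖Σ_{N<n≤2N} μψe(−φ)‖ ≥ N/log^A N` then `φ'' ` is major arc of height `log^B N` on a Bohr ball of
radius `≥ log^{-B} N`, in the gauge/`ℝ/ℤ` vocabulary of `…MNTwoMajorArcFinal`) it derives
PROPOSITION 19 in the exact printed form consumed by `…MNTwoSectionEight.sum_moebius_localQuadratic_le`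
(hypothesis `hP` there), using `…MNTwoMajorArcFinal.norm_sum_moebius_major_arc_le` (§12) and the
vocabulary conversions of `…MNTwoPropNineteenGlue`.  Hence, once `hInv` is proved,
`stub_mnVertical` reduces to Theorem 4 (landed, V3) + App. A Prop. 5 (block V7).

* `weight_le_three_halves` — a Prop-19 weight satisfies `ψ ≤ 3/2`;
* `propNineteen_of_majorArcInverse` — **Prop. 19 ⟸ major-arc inverse statement**.

References: [GreenTao2008QuadraticMobius] arXiv:math/0606087 Prop. 19, §§9–12.
-/

noncomputable section

open Finset Real ArithmeticFunction
open scoped ArithmeticFunction.Moebius FourierTransform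

namespace Summit.Parity.GeneralizedHardyLittlewood.GreenTaoLevelTwoMNTwoPropNineteenOfInverse

open Summit.Parity.GeneralizedHardyLittlewood.GreenTaoLevelTwoMNTwoMajorArcFinal
  (norm_sum_moebius_major_arc_le)
open Summit.Parity.GeneralizedHardyLittlewood.GreenTaoLevelTwoMNTwoPropNineteenGlue
  (sum_toCircle_eq_sum_fourierChar cube_vanish_of_integral)
open Summit.Parity.GeneralizedHardyLittlewood.GreenTaoLevelTwoMNTwoBohrGauge
  (bddAbove_range_norm iSup_norm_nonneg)

variable {k : ℕ}

/-- A Prop-19 weight (nonnegative, supported on `B_α(n₀,ρ) ⊆ (N,2N]` with `ρ < 1/2`, Lipschitz in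
`t`-form) is bounded by `3/2`: compare `n` with `n + N`, which lies outside the support.
[cite: GreenTao2008QuadraticMobius, §8 ("`‖ψ‖_∞ ≪ ρ₀ ≪ 1`")] -/
theorem weight_le_three_halves (α : Fin k → ℝ) {N : ℕ} (hN : 1 ≤ N) (n₀ : ℤ) {ρ : ℝ}
    (hρ : 2 * ρ < 1) (ψ : ℤ → ℝ) (hψ0 : ∀ n, 0 ≤ ψ n)
    (hsupp : ∀ n, ψ n ≠ 0 →
      (∀ i, ‖((((n - n₀ : ℤ) : ℝ) * α i : ℝ) : AddCircle (1 : ℝ))‖ +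
          |((n - n₀ : ℤ) : ℝ)| / N < ρ) ∧ |((n - n₀ : ℤ) : ℝ)| / N < ρ)
    (hlip : ∀ (n n' : ℤ) (t : ℝ), 0 ≤ t →
      (∀ i, ‖((((n - n' : ℤ) : ℝ) * α i : ℝ) : AddCircle (1 : ℝ))‖ ≤ t) →
        |ψ n - ψ n'| ≤ t + |((n - n' : ℤ) : ℝ)| / N) (n : ℤ) :
    ψ n ≤ 3 / 2 := by
  have hNr : (0 : ℝ) < N := by exact_mod_cast hN
  by_cases hn : ψ n = 0
  · rw [hn]; norm_num
  have hn' : ψ (n + N) = 0 := by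
    by_contra h
    have h1 := (hsupp n hn).2
    have h2 := (hsupp (n + N) h).2
    have e : ((n + N - n₀ : ℤ) : ℝ) = ((n - n₀ : ℤ) : ℝ) + N := by push_cast; ring
    rw [e] at h2
    set x : ℝ := ((n - n₀ : ℤ) : ℝ) with hx
    have h3 : (N : ℝ) ≤ |x + N| + |x| := by
      calc (N : ℝ) = |(x + N) + -x| := by rw [show x + N + -x = (N : ℝ) by ring, abs_of_pos hNr]
        _ ≤ |x + N| + |-x| := abs_add_le _ _
        _ = |x + N| + |x| := by rw [abs_neg]
    rw [div_lt_iff₀ hNr] at h1 h2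
    nlinarith
  have h := hlip n (n + N) (1 / 2) (by norm_num) (fun i => by
    have := AddCircle.norm_le_half_period (1 : ℝ)
      (x := ((((n - (n + N) : ℤ) : ℝ) * α i : ℝ) : AddCircle (1 : ℝ))) one_ne_zero
    rwa [abs_one] at this)
  rw [hn', sub_zero, abs_of_nonneg (hψ0 n)] at h
  have e : ((n - (n + N) : ℤ) : ℝ) = -N := by push_cast; ring
  rw [e, abs_neg, abs_of_pos hNr, div_self hNr.ne'] at h
  linarith

/-- **Proposition 19 from the major-arc inverse statement (GT 2008b §§9–12 assembled).**  The
hypothesis `hInv` is the deliverable of §§9–11: whenever the Prop-19 data `(α, n₀, ρ, φ, ψ)` has a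
large sum, `‖Σ_{N<n≤2N} μ(n)ψ(n)e(−φ(n))‖ ≥ N/log^A N`, the phase `φ'' = (↑∘φ)''` (based at `n₀`) is
major arc of height `log^B N`: `1 ≤ q ≤ log^B N`, `0 ≤ K ≤ log^B N`, `log^{-B} N ≤ ρ₃ ≤ ρ`, and
`‖q•φ''(a,b)‖ ≤ K ν(a)ν(b)` for `ν a, ν b < ρ₃`.  The conclusion is Proposition 19 verbatim as the
hypothesis `hP` of `…MNTwoSectionEight.sum_moebius_localQuadratic_dyadic_le`.
[cite: GreenTao2008QuadraticMobius, Proposition 19, §§9–12] -/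
theorem propNineteen_of_majorArcInverse (k : ℕ)
    (hInv : ∀ A : ℝ, 0 < A → ∃ B : ℝ, 0 ≤ B ∧ ∀ N : ℕ, 2 ≤ N → ∀ (α : Fin k → ℝ) (n₀ : ℤ) (ρ : ℝ),
      0 < ρ → 100000 * ρ < 1 →
      (∀ n : ℤ, ((∀ i, ‖((((n - n₀ : ℤ) : ℝ) * α i : ℝ) : AddCircle (1 : ℝ))‖ +
          |((n - n₀ : ℤ) : ℝ)| / N < 100 * ρ) ∧ |((n - n₀ : ℤ) : ℝ)| / N < 100 * ρ) →
        (N : ℤ) < n ∧ n ≤ 2 * N) →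
      ∀ φ : ℤ → ℝ,
        (∀ n h₁ h₂ h₃ : ℤ,
          (∀ e₁ e₂ e₃ : ℕ, e₁ ≤ 1 → e₂ ≤ 1 → e₃ ≤ 1 →
            (∀ i, ‖((((n + e₁ * h₁ + e₂ * h₂ + e₃ * h₃ - n₀ : ℤ) : ℝ) * α i : ℝ) :
                AddCircle (1 : ℝ))‖ +
              |((n + e₁ * h₁ + e₂ * h₂ + e₃ * h₃ - n₀ : ℤ) : ℝ)| / N < 100 * ρ) ∧
            |((n + e₁ * h₁ + e₂ * h₂ + e₃ * h₃ - n₀ : ℤ) : ℝ)| / N < 100 * ρ) →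
          ∃ z : ℤ, φ (n + h₁ + h₂ + h₃) - φ (n + h₁ + h₂) - φ (n + h₁ + h₃) - φ (n + h₂ + h₃)
            + φ (n + h₁) + φ (n + h₂) + φ (n + h₃) - φ n = z) →
        ∀ ψ : ℤ → ℝ, (∀ n, 0 ≤ ψ n) →
          (∀ n, ψ n ≠ 0 →
            (∀ i, ‖((((n - n₀ : ℤ) : ℝ) * α i : ℝ) : AddCircle (1 : ℝ))‖ +
                |((n - n₀ : ℤ) : ℝ)| / N < ρ) ∧ |((n - n₀ : ℤ) : ℝ)| / N < ρ) →
          (∀ (n n' : ℤ) (t : ℝ), 0 ≤ t →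
            (∀ i, ‖((((n - n' : ℤ) : ℝ) * α i : ℝ) : AddCircle (1 : ℝ))‖ ≤ t) →
              |ψ n - ψ n'| ≤ t + |((n - n' : ℤ) : ℝ)| / N) →
          (N : ℝ) / Real.log N ^ A ≤
            ‖∑ n ∈ Ioc N (2 * N), ((μ n : ℝ) : ℂ) * ((ψ n : ℝ) : ℂ) * (𝐞 (-(φ n)) : ℂ)‖ →
          ∃ (q : ℕ) (K ρ₃ : ℝ), 1 ≤ q ∧ (q : ℝ) ≤ Real.log N ^ B ∧ 0 ≤ K ∧ K ≤ Real.log N ^ B ∧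
            (Real.log N ^ B)⁻¹ ≤ ρ₃ ∧ ρ₃ ≤ ρ ∧
            ∀ a b : ℤ,
              (⨆ i : Fin k, ‖(((a : ℝ) * α i : ℝ) : AddCircle (1 : ℝ))‖) + |(a : ℝ)| / N < ρ₃ →
              (⨆ i : Fin k, ‖(((b : ℝ) * α i : ℝ) : AddCircle (1 : ℝ))‖) + |(b : ℝ)| / N < ρ₃ →
              ‖q • ((((φ (n₀ + a + b) : ℝ) : UnitAddCircle)) - ((φ (n₀ + a) : ℝ) : UnitAddCircle)
                - ((φ (n₀ + b) : ℝ) : UnitAddCircle) + ((φ n₀ : ℝ) : UnitAddCircle))‖ ≤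
                K * ((⨆ i : Fin k, ‖(((a : ℝ) * α i : ℝ) : AddCircle (1 : ℝ))‖) + |(a : ℝ)| / N) *
                  ((⨆ i : Fin k, ‖(((b : ℝ) * α i : ℝ) : AddCircle (1 : ℝ))‖) + |(b : ℝ)| / N)) :
    ∀ A : ℝ, 0 < A → ∃ C : ℝ, ∀ N : ℕ, 2 ≤ N → ∀ (α : Fin k → ℝ) (n₀ : ℤ) (ρ : ℝ),
      0 < ρ → 100000 * ρ < 1 →
      (∀ n : ℤ, ((∀ i, ‖((((n - n₀ : ℤ) : ℝ) * α i : ℝ) : AddCircle (1 : ℝ))‖ +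
          |((n - n₀ : ℤ) : ℝ)| / N < 100 * ρ) ∧ |((n - n₀ : ℤ) : ℝ)| / N < 100 * ρ) →
        (N : ℤ) < n ∧ n ≤ 2 * N) →
      ∀ φ : ℤ → ℝ,
        (∀ n h₁ h₂ h₃ : ℤ,
          (∀ e₁ e₂ e₃ : ℕ, e₁ ≤ 1 → e₂ ≤ 1 → e₃ ≤ 1 →
            (∀ i, ‖((((n + e₁ * h₁ + e₂ * h₂ + e₃ * h₃ - n₀ : ℤ) : ℝ) * α i : ℝ) :
                AddCircle (1 : ℝ))‖ +
              |((n + e₁ * h₁ + e₂ * h₂ + e₃ * h₃ - n₀ : ℤ) : ℝ)| / N < 100 * ρ) ∧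
            |((n + e₁ * h₁ + e₂ * h₂ + e₃ * h₃ - n₀ : ℤ) : ℝ)| / N < 100 * ρ) →
          ∃ z : ℤ, φ (n + h₁ + h₂ + h₃) - φ (n + h₁ + h₂) - φ (n + h₁ + h₃) - φ (n + h₂ + h₃)
            + φ (n + h₁) + φ (n + h₂) + φ (n + h₃) - φ n = z) →
        ∀ ψ : ℤ → ℝ, (∀ n, 0 ≤ ψ n) →
          (∀ n, ψ n ≠ 0 →
            (∀ i, ‖((((n - n₀ : ℤ) : ℝ) * α i : ℝ) : AddCircle (1 : ℝ))‖ +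
                |((n - n₀ : ℤ) : ℝ)| / N < ρ) ∧ |((n - n₀ : ℤ) : ℝ)| / N < ρ) →
          (∀ (n n' : ℤ) (t : ℝ), 0 ≤ t →
            (∀ i, ‖((((n - n' : ℤ) : ℝ) * α i : ℝ) : AddCircle (1 : ℝ))‖ ≤ t) →
              |ψ n - ψ n'| ≤ t + |((n - n' : ℤ) : ℝ)| / N) →
          ‖∑ n ∈ Ioc N (2 * N), ((μ n : ℝ) : ℂ) * ((ψ n : ℝ) : ℂ) * (𝐞 (-(φ n)) : ℂ)‖ ≤
            C * N / Real.log N ^ A := by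
  intro A hA
  obtain ⟨B, hB0, hB⟩ := hInv A hA
  set D : ℕ := (k + 1) * (k + 3) + 2 * k + 3 with hD
  obtain ⟨C₁, hC₁0, hC₁⟩ := norm_sum_moebius_major_arc_le k (A := A + B * D) (by positivity)
  refine ⟨2 * C₁ + 2, ?_⟩
  intro N hN α n₀ ρ hρ hρ1 hball φ hφ ψ hψ0 hsupp hlip
  have hN1 : 1 ≤ N := by omega
  have hNr : (0 : ℝ) < N := by exact_mod_cast (show 0 < N by omega)
  have hlogpos : 0 < Real.log N := Real.log_pos (by exact_mod_cast (show 1 < N by omega))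
  have hLA : 0 < Real.log N ^ A := Real.rpow_pos_of_pos hlogpos A
  -- trivial bound `‖Σ‖ ≤ (3/2) N`
  have hψ32 : ∀ n, ψ n ≤ 3 / 2 :=
    weight_le_three_halves α hN1 n₀ (by linarith) ψ hψ0 hsupp hlip
  have htriv : ‖∑ n ∈ Ioc N (2 * N), ((μ n : ℝ) : ℂ) * ((ψ n : ℝ) : ℂ) * (𝐞 (-(φ n)) : ℂ)‖ ≤
      3 / 2 * N := by
    calc _ ≤ ∑ n ∈ Ioc N (2 * N), ‖((μ n : ℝ) : ℂ) * ((ψ n : ℝ) : ℂ) * (𝐞 (-(φ n)) : ℂ)‖ :=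
          norm_sum_le _ _
      _ ≤ ∑ _n ∈ Ioc N (2 * N), (3 / 2 : ℝ) := Finset.sum_le_sum fun n _ => by
          rw [norm_mul, norm_mul, Circle.norm_coe, mul_one, Complex.norm_real, Complex.norm_real,
            Real.norm_eq_abs, Real.norm_eq_abs, abs_of_nonneg (hψ0 n)]
          have h1 : |((μ n : ℝ))| ≤ 1 := by exact_mod_cast abs_moebius_le_one
          have := hψ32 n
          nlinarith [abs_nonneg ((μ n : ℝ)), hψ0 n]
      _ = 3 / 2 * N := by simp [show 2 * N - N = N by omega]; ring
  -- Case: the sum is small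
  by_cases hcase : ‖∑ n ∈ Ioc N (2 * N), ((μ n : ℝ) : ℂ) * ((ψ n : ℝ) : ℂ) * (𝐞 (-(φ n)) : ℂ)‖ <
      (N : ℝ) / Real.log N ^ A
  · refine hcase.le.trans ?_
    rw [div_le_div_iff_of_pos_right hLA]; nlinarith
  push Not at hcase
  -- Case `log N ≤ 1`: trivial bound
  by_cases hsmall : Real.log N ≤ 1
  · have hΛ1 : Real.log N ^ A ≤ 1 := Real.rpow_le_one hlogpos.le hsmall hA.le
    refine htriv.trans ?_
    rw [le_div_iff₀ hLA]
    nlinarith [mul_le_mul_of_nonneg_left hΛ1 hNr.le]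
  push Not at hsmall
  -- the major-arc data
  obtain ⟨q, K, ρ₃, hq, hqB, hK, hKB, hρ₃B, hρ₃ρ, hMA⟩ :=
    hB N hN α n₀ ρ hρ hρ1 hball φ hφ ψ hψ0 hsupp hlip hcase
  set Q : ℝ := Real.log N ^ B with hQ
  have hQ1 : 1 ≤ Q := Real.one_le_rpow hsmall.le hB0
  have hQρ : 1 / Q ≤ ρ₃ := by rw [one_div]; exact hρ₃B
  -- the rescaled weight `ψ/2` and the `ℝ/ℤ`-valued phase
  set ψ₂ : ℤ → ℝ := fun n => ψ n / 2 with hψ₂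
  set φ' : ℤ → UnitAddCircle := fun n => ((φ n : ℝ) : UnitAddCircle) with hφ'
  have hψ₂0 : ∀ n, 0 ≤ ψ₂ n := fun n => by simp only [hψ₂]; linarith [hψ0 n]
  have hψ₂1 : ∀ n, ψ₂ n ≤ 1 := fun n => by simp only [hψ₂]; linarith [hψ32 n]
  have hψ₂ne : ∀ n, ψ₂ n ≠ 0 → ψ n ≠ 0 := fun n h h0 => h (by simp only [hψ₂, h0, zero_div])
  have hsupp₂ : ∀ n, ψ₂ n ≠ 0 → (N : ℤ) < n ∧ n ≤ 2 * N := by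
    intro n hn
    have h := hsupp n (hψ₂ne n hn)
    refine hball n ⟨fun i => ?_, ?_⟩
    · have := h.1 i; linarith
    · linarith [h.2]
  have hloc₂ : ∀ n, ψ₂ n ≠ 0 →
      (⨆ i : Fin k, ‖((((n - n₀ : ℤ) : ℝ) * α i : ℝ) : AddCircle (1 : ℝ))‖) +
        |((n - n₀ : ℤ) : ℝ)| / N < ρ := by
    intro n hn
    have h := hsupp n (hψ₂ne n hn)
    rcases isEmpty_or_nonempty (Fin k) with hk | hk
    · rw [Real.iSup_of_isEmpty, zero_add]; exact h.2
    · obtain ⟨i, hi⟩ := exists_eq_ciSup_of_finite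
        (f := fun i : Fin k => ‖((((n - n₀ : ℤ) : ℝ) * α i : ℝ) : AddCircle (1 : ℝ))‖)
      rw [← hi]; exact h.1 i
  have hlip₂ : ∀ n n' : ℤ, |ψ₂ n - ψ₂ n'| ≤
      (⨆ i : Fin k, ‖((((n - n' : ℤ) : ℝ) * α i : ℝ) : AddCircle (1 : ℝ))‖) +
        |((n - n' : ℤ) : ℝ)| / N := by
    intro n n'
    have h := hlip n n' (⨆ i : Fin k, ‖((((n - n' : ℤ) : ℝ) * α i : ℝ) : AddCircle (1 : ℝ))‖)
      (iSup_norm_nonneg α _) (fun i => le_ciSup (bddAbove_range_norm α (n - n')) i)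
    have e : ψ₂ n - ψ₂ n' = (ψ n - ψ n') / 2 := by simp only [hψ₂]; ring
    rw [e, abs_div, abs_two]
    have := abs_nonneg (ψ n - ψ n')
    have h0 : 0 ≤ (⨆ i : Fin k, ‖((((n - n' : ℤ) : ℝ) * α i : ℝ) : AddCircle (1 : ℝ))‖) +
        |((n - n' : ℤ) : ℝ)| / N := by have := iSup_norm_nonneg α (n - n'); positivity
    linarith
  have hφ' := cube_vanish_of_integral α N n₀ (100 * ρ) φ hφ
  -- apply §12
  have main := hC₁ N hN α n₀ (100 * ρ) K ρ₃ ρ Q q φ' ψ₂ hφ' hq hK hQ1 hqB hKB hQρ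
    (by linarith) (by linarith) hMA hψ₂0 hψ₂1 hsupp₂ hloc₂ hlip₂
  -- rescale and convert back
  have hconv : ∑ n ∈ Ioc N (2 * N), ((μ n : ℝ) : ℂ) * ((ψ n : ℝ) : ℂ) * (𝐞 (-(φ n)) : ℂ) =
      2 * ∑ n ∈ Ioc N (2 * N), ((μ n : ℝ) : ℂ) * ((ψ₂ n : ℝ) : ℂ) *
        ((AddCircle.toCircle (-φ' n) : Circle) : ℂ) := by
    rw [Finset.mul_sum, ← sum_toCircle_eq_sum_fourierChar]
    refine Finset.sum_congr rfl fun n _ => ?_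
    simp only [hψ₂]
    push_cast
    ring
  rw [hconv, norm_mul, Complex.norm_two]
  have hpow : Real.log N ^ (A + B * D) = Real.log N ^ A * Q ^ D := by
    rw [Real.rpow_add hlogpos, hQ, ← Real.rpow_mul_natCast hlogpos.le]
  rw [hpow] at main
  have hQD : 0 < Q ^ D := by positivity
  have main' : ‖∑ n ∈ Ioc N (2 * N), ((μ n : ℝ) : ℂ) * ((ψ₂ n : ℝ) : ℂ) *
      ((AddCircle.toCircle (-φ' n) : Circle) : ℂ)‖ ≤ C₁ * N / Real.log N ^ A := by
    refine main.trans (le_of_eq ?_)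
    rw [hD]
    field_simp
  calc 2 * ‖∑ n ∈ Ioc N (2 * N), ((μ n : ℝ) : ℂ) * ((ψ₂ n : ℝ) : ℂ) *
        ((AddCircle.toCircle (-φ' n) : Circle) : ℂ)‖ ≤ 2 * (C₁ * N / Real.log N ^ A) := by linarith
    _ ≤ (2 * C₁ + 2) * N / Real.log N ^ A := by
        rw [mul_div_assoc, mul_div_assoc]
        have : 0 ≤ (N : ℝ) / Real.log N ^ A := by positivity
        nlinarith

end Summit.Parity.GeneralizedHardyLittlewood.GreenTaoLevelTwoMNTwoPropNineteenOfInverse
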